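import Summits.ValiantsHypothesis.ValiantsHypothesis.Theorems.BinomialElusivePeelingLemmaWindowDefs

/-!
# Girth counting lemma for letter incidences (all-X designs against `BinomialElusive.PeelingLemma`)

Helper for the crux stmt-ValiantsHypothesis-7391 (negative lane; `Cruxes/PeelingLemma/DETERMINISTIC-ALLX.md`
§4, module [Gir]): the DETERMINISTIC replacement of the first-moment step of the all-X refutation.
Gadgets `a : α` carry letter sets `Λ a`; a relation of cost `≤ ℓ` yields a nonempty finite set `P`
of participating gadgets, support letters `S a ⊆ Λ a` with `|S a| ≥ 4`, and every support letter of
`a` is a support letter of another participating gadget (coefficients must cancel).  If `Λ` has no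
closed alternating walk, non-backtracking at interior points, of length `1 ≤ L ≤ 2j`, then
`3^j ≤ |P|` (`three_pow_le_card`): non-backtracking walks of length `r` from a root inside the support
incidences number `≥ 3^r` (`three_pow_le_card_validWalks`) and distinct walks of length `j` have
distinct endpoints (`endGad_injOn`).  Vocabulary (`HasShortClosedWalk`, `gadAt`, `letAt`, `IsValid`,
`validWalks`) in `BinomialElusivePeelingLemmaWindowDefs.lean`.  Pure combinatorics; no Theses import.
-/

namespace Summit.ValiantsHypothesis.ValiantsHypothesis.Theorems.PeelingLemmaGirth

-- summit = sub-problem name (single-conjunct summit, D-0017 layout), so the namespace repeats it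
set_option linter.dupNamespace false

open scoped BigOperators
open Finset
variable {α β : Type*} [DecidableEq α] [DecidableEq β]

omit [DecidableEq α] [DecidableEq β] in
/-- The walk starts at the root. -/
theorem gadAt_zero (a₀ : α) {r : ℕ} (w : Fin r → β × α) : gadAt a₀ w 0 = a₀ := by
  simp [gadAt]

omit [DecidableEq α] [DecidableEq β] in
/-- After step `i` the walk is at the gadget of step `i`. -/
theorem gadAt_succ (a₀ : α) {r : ℕ} (w : Fin r → β × α) (i : ℕ) (h : i < r) :
    gadAt a₀ w (i + 1) = (w ⟨i, h⟩).2 := by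
  simp [gadAt, h]

omit [DecidableEq α] [DecidableEq β] in
/-- The letter of step `i`. -/
theorem letAt_of_lt (μ₀ : β) {r : ℕ} (w : Fin r → β × α) (i : ℕ) (h : i < r) :
    letAt μ₀ w i = (w ⟨i, h⟩).1 := by
  simp [letAt, h]

omit [DecidableEq α] in
/-- Membership in `validWalks` is validity. -/
theorem mem_validWalks {S : α → Finset β} {P : Finset α} {a₀ : α} {r : ℕ} {w : Fin r → β × α} :
    w ∈ validWalks S P a₀ r ↔ IsValid S P a₀ w := by
  classical
  unfold validWalks
  simp only [Finset.mem_filter, Fintype.mem_piFinset, Finset.mem_product, Finset.mem_biUnion,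
    and_iff_right_iff_imp]
  intro hv i
  obtain ⟨hP, _, hS2, _⟩ := hv.1 i
  exact ⟨⟨(w i).2, hP, hS2⟩, hP⟩

omit [DecidableEq α] [DecidableEq β] in
/-- The validity conditions in `ℕ`-indexed form (steps `i < r`). -/
theorem isValid_nat {S : α → Finset β} {P : Finset α} {a₀ : α} (μ₀ : β) {r : ℕ}
    {w : Fin r → β × α} (hv : IsValid S P a₀ w) :
    (∀ i < r, gadAt a₀ w (i + 1) ∈ P ∧ letAt μ₀ w i ∈ S (gadAt a₀ w i) ∧
        letAt μ₀ w i ∈ S (gadAt a₀ w (i + 1)) ∧ gadAt a₀ w i ≠ gadAt a₀ w (i + 1)) ∧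
    (∀ i, i + 1 < r → letAt μ₀ w i ≠ letAt μ₀ w (i + 1)) := by
  refine ⟨fun i hi => ?_, fun i hi => ?_⟩
  · obtain ⟨hP, hS1, hS2, hne⟩ := hv.1 ⟨i, hi⟩
    rw [gadAt_succ a₀ w i hi, letAt_of_lt μ₀ w i hi]
    exact ⟨hP, hS1, hS2, hne.symm⟩
  · rw [letAt_of_lt μ₀ w i (by omega), letAt_of_lt μ₀ w (i + 1) hi]
    exact hv.2 ⟨i, by omega⟩ hi


omit [DecidableEq α] [DecidableEq β] in
/-- Along a valid walk every step is an incidence of `Λ ⊇ S` at both ends, between distinct gadgets. -/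
theorem isValid_stepΛ {Λ S : α → Finset β} {P : Finset α} {a₀ : α} (μ₀ : β)
    (hS : ∀ a ∈ P, S a ⊆ Λ a) (ha₀ : a₀ ∈ P) {r : ℕ} {w : Fin r → β × α} (hv : IsValid S P a₀ w) :
    ∀ i < r, letAt μ₀ w i ∈ Λ (gadAt a₀ w i) ∧ letAt μ₀ w i ∈ Λ (gadAt a₀ w (i + 1)) ∧
      gadAt a₀ w i ≠ gadAt a₀ w (i + 1) := by
  intro i hi
  obtain ⟨hstep, -⟩ := isValid_nat μ₀ hv
  obtain ⟨hP1, hS1, hS2, hne⟩ := hstep i hi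
  have hP0 : gadAt a₀ w i ∈ P := by
    rcases Nat.eq_zero_or_pos i with h0 | h0
    · subst h0; rw [gadAt_zero]; exact ha₀
    · have := (hstep (i - 1) (by omega)).1; rwa [show i - 1 + 1 = i by omega] at this
  exact ⟨hS _ hP0 hS1, hS _ hP1 hS2, hne⟩

/-! ## Extension: every valid walk extends in at least three ways -/
omit [DecidableEq α] [DecidableEq β] in
/-- Appending a step does not change the gadgets reached before it. -/
theorem gadAt_snoc_of_le (a₀ : α) {r : ℕ} (w : Fin r → β × α) (x : β × α) (i : ℕ) (hi : i ≤ r) :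
    gadAt a₀ (Fin.snoc w x : Fin (r + 1) → β × α) i = gadAt a₀ w i := by
  unfold gadAt
  by_cases h0 : 0 < i
  · have h1 : i - 1 < r := by omega
    have h2 : i - 1 < r + 1 := by omega
    rw [dif_pos ⟨h0, h2⟩, dif_pos ⟨h0, h1⟩]
    have : (⟨i - 1, h2⟩ : Fin (r + 1)) = Fin.castSucc ⟨i - 1, h1⟩ := rfl
    rw [this, Fin.snoc_castSucc]
  · rw [dif_neg (fun h => h0 h.1), dif_neg (fun h => h0 h.1)]

omit [DecidableEq α] [DecidableEq β] in
/-- Dropping the last step does not change the gadgets reached before it. -/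
theorem gadAt_init (a₀ : α) {r : ℕ} (w : Fin (r + 1) → β × α) (i : ℕ) (hi : i ≤ r) :
    gadAt a₀ (Fin.init w) i = gadAt a₀ w i := by
  conv_rhs => rw [← Fin.snoc_init_self w]
  rw [gadAt_snoc_of_le a₀ (Fin.init w) (w (Fin.last r)) i hi]

omit [DecidableEq α] in
/-- The initial segment of a valid walk is valid. -/
theorem init_mem_validWalks {S : α → Finset β} {P : Finset α} {a₀ : α} {r : ℕ}
    {w : Fin (r + 1) → β × α} (hw : w ∈ validWalks S P a₀ (r + 1)) :
    Fin.init w ∈ validWalks S P a₀ r := by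
  rw [mem_validWalks] at hw ⊢
  refine ⟨fun i => ?_, fun i h => ?_⟩
  · have hg : gadAt a₀ (Fin.init w) i = gadAt a₀ w (Fin.castSucc i) := by
      rw [gadAt_init a₀ w i (by omega)]; rfl
    rw [hg]
    exact hw.1 (Fin.castSucc i)
  · have := hw.2 (Fin.castSucc i) (by rw [Fin.val_castSucc]; omega)
    simpa [Fin.init] using this

omit [DecidableEq α] in
/-- Extending a valid walk by a support letter `ν` of its endpoint `e` (different from the letter just
used) to a partner gadget `a' ≠ e` supporting `ν` gives a valid walk. -/
theorem snoc_mem_validWalks {S : α → Finset β} {P : Finset α} {a₀ : α} {r : ℕ}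
    {w : Fin r → β × α} (hw : w ∈ validWalks S P a₀ r) {ν : β} {a' : α}
    (hνe : ν ∈ S (gadAt a₀ w r)) (ha'P : a' ∈ P) (hνa' : ν ∈ S a') (hne : a' ≠ gadAt a₀ w r)
    (hnb : ∀ h : 0 < r, ν ≠ (w ⟨r - 1, by omega⟩).1) :
    (Fin.snoc w (ν, a') : Fin (r + 1) → β × α) ∈ validWalks S P a₀ (r + 1) := by
  rw [mem_validWalks] at hw ⊢
  refine ⟨fun i => ?_, fun i h => ?_⟩
  · rw [gadAt_snoc_of_le a₀ w (ν, a') i (by omega)]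
    by_cases hi : (i : ℕ) < r
    · have : i = Fin.castSucc ⟨i, hi⟩ := rfl
      rw [this, Fin.snoc_castSucc]
      exact hw.1 ⟨i, hi⟩
    · have hir : (i : ℕ) = r := by omega
      have : i = Fin.last r := Fin.ext hir
      rw [this, Fin.snoc_last]
      simp only [Fin.val_last]
      exact ⟨ha'P, hνe, hνa', hne⟩
  · -- consecutive letters differ
    obtain ⟨i, hi'⟩ := i
    simp only at h
    by_cases hi : i + 1 < r
    · have e1 : (Fin.snoc w (ν, a') : Fin (r + 1) → β × α) ⟨i, hi'⟩ = w ⟨i, by omega⟩ := by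
        show (Fin.snoc w (ν, a') : Fin (r + 1) → β × α) (Fin.castSucc ⟨i, by omega⟩) = _
        rw [Fin.snoc_castSucc]
      have e2 : (Fin.snoc w (ν, a') : Fin (r + 1) → β × α) ⟨i + 1, h⟩ = w ⟨i + 1, hi⟩ := by
        show (Fin.snoc w (ν, a') : Fin (r + 1) → β × α) (Fin.castSucc ⟨i + 1, hi⟩) = _
        rw [Fin.snoc_castSucc]
      rw [e1, e2]
      exact hw.2 ⟨i, by omega⟩ hi
    · -- the new last letter versus the previous last letter
      have hir : i + 1 = r := by omega
      have e1 : (Fin.snoc w (ν, a') : Fin (r + 1) → β × α) ⟨i, hi'⟩ = w ⟨r - 1, by omega⟩ := by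
        have : (⟨i, hi'⟩ : Fin (r + 1)) = Fin.castSucc ⟨r - 1, by omega⟩ :=
          Fin.ext (by simp only [Fin.val_castSucc]; omega)
        rw [this, Fin.snoc_castSucc]
      have e2 : (Fin.snoc w (ν, a') : Fin (r + 1) → β × α) ⟨i + 1, h⟩ = (ν, a') := by
        have : (⟨i + 1, h⟩ : Fin (r + 1)) = Fin.last r := Fin.ext (by rw [Fin.val_last]; omega)
        rw [this, Fin.snoc_last]
      rw [e1, e2]
      exact fun heq => hnb (by omega) heq.symm

/-- **Growth.**  With `≥ 4` support letters per participating gadget and a partner for every support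
letter, the valid walks of length `r + 1` are at least three times as many as those of length `r`. -/
theorem card_validWalks_succ {S : α → Finset β} {P : Finset α} {a₀ : α} (ha₀ : a₀ ∈ P)
    (h4 : ∀ a ∈ P, 4 ≤ (S a).card)
    (hcover : ∀ a ∈ P, ∀ μ ∈ S a, ∃ a' ∈ P, a' ≠ a ∧ μ ∈ S a') (r : ℕ) :
    3 * (validWalks S P a₀ r).card ≤ (validWalks S P a₀ (r + 1)).card := by
  classical
  -- fibre decomposition along `Fin.init`
  rw [Finset.card_eq_sum_card_fiberwise (f := fun w : Fin (r + 1) → β × α => Fin.init w)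
    (t := validWalks S P a₀ r) (fun w hw => init_mem_validWalks hw)]
  calc 3 * (validWalks S P a₀ r).card = ∑ _w ∈ validWalks S P a₀ r, 3 := by
        rw [Finset.sum_const, smul_eq_mul, mul_comm]
    _ ≤ _ := Finset.sum_le_sum fun w hw => ?_
  -- the fibre over `w` contains the ≥ 3 extensions by support letters of the endpoint
  have hv := mem_validWalks.mp hw
  set e := gadAt a₀ w r with he
  have heP : e ∈ P := by
    rcases Nat.eq_zero_or_pos r with hr | hr
    · subst hr; simpa [e, gadAt] using ha₀
    · have := (hv.1 ⟨r - 1, by omega⟩).1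
      have hg := gadAt_succ a₀ w (r - 1) (by omega)
      rw [show r - 1 + 1 = r by omega] at hg
      rw [he, hg]; exact this
  -- letters available: S e minus the letter just used (if any)
  let used : Finset β := if h : 0 < r then {(w ⟨r - 1, by omega⟩).1} else ∅
  have hused : used.card ≤ 1 := by
    simp only [used]; split_ifs <;> simp
  let avail := S e \ used
  have havail : 3 ≤ avail.card := by
    have h1 : (S e).card - used.card ≤ avail.card := by
      simp only [avail]
      have := Finset.le_card_sdiff used (S e)
      omega
    have := h4 e heP
    omega
  -- partner choice
  have hpart : ∀ ν ∈ avail, ∃ a' ∈ P, a' ≠ e ∧ ν ∈ S a' := fun ν hν =>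
    hcover e heP ν (Finset.mem_sdiff.mp hν).1
  haveI : Nonempty α := ⟨a₀⟩
  choose! partner hpartner using hpart
  let ext : β → (Fin (r + 1) → β × α) := fun ν => Fin.snoc w (ν, partner ν)
  have hinj : Set.InjOn ext avail := by
    intro ν _ ν' _ hνν'
    have := congrFun hνν' (Fin.last r)
    simp only [ext, Fin.snoc_last, Prod.mk.injEq] at this
    exact this.1
  have hmaps : ∀ ν ∈ avail, ext ν ∈ (validWalks S P a₀ (r + 1)).filter
      (fun w' : Fin (r + 1) → β × α => Fin.init w' = w) := by
    intro ν hν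
    obtain ⟨ha'P, hne, hνa'⟩ := hpartner ν hν
    have hνS : ν ∈ S e := (Finset.mem_sdiff.mp hν).1
    have hνu : ν ∉ used := (Finset.mem_sdiff.mp hν).2
    refine Finset.mem_filter.mpr ⟨?_, by simp [ext, Fin.init_snoc]⟩
    refine snoc_mem_validWalks hw hνS ha'P hνa' hne fun h => ?_
    intro hνeq
    apply hνu
    simp only [used, dif_pos h, Finset.mem_singleton]
    exact hνeq
  calc 3 ≤ avail.card := havail
    _ ≤ _ := Finset.card_le_card_of_injOn ext hmaps hinj

/-- At least `3^r` valid walks of length `r`. -/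
theorem three_pow_le_card_validWalks {S : α → Finset β} {P : Finset α} {a₀ : α} (ha₀ : a₀ ∈ P)
    (h4 : ∀ a ∈ P, 4 ≤ (S a).card)
    (hcover : ∀ a ∈ P, ∀ μ ∈ S a, ∃ a' ∈ P, a' ≠ a ∧ μ ∈ S a') (r : ℕ) :
    3 ^ r ≤ (validWalks S P a₀ r).card := by
  induction r with
  | zero =>
    -- the empty walk is valid
    have : (fun i : Fin 0 => ((i.elim0 : β × α))) ∈ validWalks S P a₀ 0 := by
      rw [mem_validWalks]; exact ⟨fun i => i.elim0, fun i => i.elim0⟩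
    simpa using Finset.card_pos.mpr ⟨_, this⟩
  | succ r ih =>
    calc 3 ^ (r + 1) = 3 * 3 ^ r := by ring
      _ ≤ 3 * (validWalks S P a₀ r).card := Nat.mul_le_mul_left 3 ih
      _ ≤ _ := card_validWalks_succ ha₀ h4 hcover r

/-! ## Endpoint injectivity from the girth hypothesis -/
/-- Two distinct valid walks of the same length `j` from `a₀` with the same endpoint close up into a
closed alternating walk of length between `1` and `2j`, non-backtracking at interior points. -/
theorem endGad_injOn {Λ S : α → Finset β} {P : Finset α} {a₀ : α} (μ₀ : β)
    (hS : ∀ a ∈ P, S a ⊆ Λ a) (ha₀ : a₀ ∈ P) :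
    ∀ j : ℕ, ¬ HasShortClosedWalk Λ (2 * j) →
      ∀ w ∈ validWalks S P a₀ j, ∀ w' ∈ validWalks S P a₀ j,
        gadAt a₀ w j = gadAt a₀ w' j → w = w' := by
  intro j
  induction j with
  | zero => intro _ w _ w' _ _; funext i; exact i.elim0
  | succ j ih =>
    intro hgirth w hw w' hw' hend
    have hv := mem_validWalks.mp hw
    have hv' := mem_validWalks.mp hw'
    obtain ⟨-, hnb⟩ := isValid_nat μ₀ hv
    obtain ⟨-, hnb'⟩ := isValid_nat μ₀ hv'
    have hΛ := isValid_stepΛ μ₀ hS ha₀ hv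
    have hΛ' := isValid_stepΛ μ₀ hS ha₀ hv'
    -- the last letters μ, μ' and the previous gadgets a, a'
    by_cases hμ : letAt μ₀ w j = letAt μ₀ w' j
    · by_cases ha : gadAt a₀ w j = gadAt a₀ w' j
      · -- Case C: same last step: the initial segments are distinct valid walks with equal endpoints
        have hinit : Fin.init w = Fin.init w' := by
          refine ih (fun hh => hgirth ?_) (Fin.init w) (init_mem_validWalks hw) (Fin.init w')
            (init_mem_validWalks hw') ?_
          · obtain ⟨L, hL1, hL2, g, m, hrest⟩ := hh
            exact ⟨L, hL1, by omega, g, m, hrest⟩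
          · rw [gadAt_init a₀ w j le_rfl, gadAt_init a₀ w' j le_rfl]; exact ha
        have hlast : w (Fin.last j) = w' (Fin.last j) := by
          have e1 : (w (Fin.last j)).1 = (w' (Fin.last j)).1 := by
            have h1 := letAt_of_lt μ₀ w j (Nat.lt_succ_self j)
            have h2 := letAt_of_lt μ₀ w' j (Nat.lt_succ_self j)
            rw [h1, h2] at hμ; exact hμ
          have e2 : (w (Fin.last j)).2 = (w' (Fin.last j)).2 := by
            have h1 := gadAt_succ a₀ w j (Nat.lt_succ_self j)
            have h2 := gadAt_succ a₀ w' j (Nat.lt_succ_self j)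
            rw [h1, h2] at hend; exact hend
          exact Prod.ext e1 e2
        calc w = Fin.snoc (Fin.init w) (w (Fin.last j)) := (Fin.snoc_init_self w).symm
          _ = Fin.snoc (Fin.init w') (w' (Fin.last j)) := by rw [hinit, hlast]
          _ = w' := Fin.snoc_init_self w'
      · -- Case B: same last letter, different previous gadgets: closed walk of length 2j+1
        exfalso
        apply hgirth
        let G : ℕ → α := fun i => if i ≤ j then gadAt a₀ w i else gadAt a₀ w' (2 * j + 1 - i)
        let M : ℕ → β := fun i => if i ≤ j then letAt μ₀ w i else letAt μ₀ w' (2 * j - i)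
        have hG1 : ∀ i, i ≤ j → G i = gadAt a₀ w i := fun i hi => by simp only [G, if_pos hi]
        have hG2 : ∀ i, ¬ i ≤ j → G i = gadAt a₀ w' (2 * j + 1 - i) := fun i hi => by
          simp only [G, if_neg hi]
        have hM1 : ∀ i, i ≤ j → M i = letAt μ₀ w i := fun i hi => by simp only [M, if_pos hi]
        have hM2 : ∀ i, ¬ i ≤ j → M i = letAt μ₀ w' (2 * j - i) := fun i hi => by
          simp only [M, if_neg hi]
        refine ⟨2 * j + 1, by omega, by omega, G, M, ?_, ?_, ?_⟩
        · rw [hG2 _ (by omega), hG1 0 (Nat.zero_le _), show 2 * j + 1 - (2 * j + 1) = 0 by omega,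
            gadAt_zero, gadAt_zero]
        · intro i hi
          by_cases hij : i < j
          · rw [hM1 i hij.le, hG1 i hij.le, hG1 (i + 1) hij]
            exact hΛ i (by omega)
          · by_cases hij' : i = j
            · subst hij'
              rw [hM1 i le_rfl, hG1 i le_rfl, hG2 (i + 1) (by omega),
                show 2 * i + 1 - (i + 1) = i by omega]
              refine ⟨(hΛ i (by omega)).1, ?_, ha⟩
              rw [hμ]; exact (hΛ' i (by omega)).1
            · rw [hM2 i (by omega), hG2 i (by omega), hG2 (i + 1) (by omega)]
              obtain ⟨m1, m2, m3⟩ := hΛ' (2 * j - i) (by omega)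
              rw [show 2 * j + 1 - i = 2 * j - i + 1 by omega,
                show 2 * j + 1 - (i + 1) = 2 * j - i by omega]
              exact ⟨m2, m1, m3.symm⟩
        · intro i hi
          by_cases hij : i + 1 ≤ j
          · rw [hM1 i (by omega), hM1 (i + 1) hij]
            exact hnb i (by omega)
          · by_cases hij' : i = j
            · subst hij'
              rw [hM1 i le_rfl, hM2 (i + 1) (by omega), hμ, show 2 * i - (i + 1) = i - 1 by omega]
              have := hnb' (i - 1) (by omega)
              rw [show i - 1 + 1 = i by omega] at this
              exact fun h => this h.symm
            · rw [hM2 i (by omega), hM2 (i + 1) (by omega),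
                show 2 * j - i = 2 * j - (i + 1) + 1 by omega]
              exact fun h => hnb' (2 * j - (i + 1)) (by omega) h.symm
    · -- Case A: different last letters: closed walk of length 2(j+1)
      exfalso
      apply hgirth
      let G : ℕ → α := fun i => if i ≤ j + 1 then gadAt a₀ w i else gadAt a₀ w' (2 * j + 2 - i)
      let M : ℕ → β := fun i => if i ≤ j then letAt μ₀ w i else letAt μ₀ w' (2 * j + 1 - i)
      have hG1 : ∀ i, i ≤ j + 1 → G i = gadAt a₀ w i := fun i hi => by simp only [G, if_pos hi]
      have hG2 : ∀ i, ¬ i ≤ j + 1 → G i = gadAt a₀ w' (2 * j + 2 - i) := fun i hi => by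
        simp only [G, if_neg hi]
      have hM1 : ∀ i, i ≤ j → M i = letAt μ₀ w i := fun i hi => by simp only [M, if_pos hi]
      have hM2 : ∀ i, ¬ i ≤ j → M i = letAt μ₀ w' (2 * j + 1 - i) := fun i hi => by
        simp only [M, if_neg hi]
      refine ⟨2 * (j + 1), by omega, le_rfl, G, M, ?_, ?_, ?_⟩
      · rw [hG2 _ (by omega), hG1 0 (Nat.zero_le _), show 2 * j + 2 - 2 * (j + 1) = 0 by omega,
          gadAt_zero, gadAt_zero]
      · intro i hi
        by_cases hij : i ≤ j
        · rw [hM1 i hij, hG1 i (by omega), hG1 (i + 1) (by omega)]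
          exact hΛ i (by omega)
        · by_cases hij' : i = j + 1
          · subst hij'
            rw [hM2 _ (by omega), hG1 _ le_rfl, hG2 _ (by omega), hend,
              show 2 * j + 1 - (j + 1) = j by omega, show 2 * j + 2 - (j + 1 + 1) = j by omega]
            obtain ⟨m1, m2, m3⟩ := hΛ' j (by omega)
            exact ⟨m2, m1, m3.symm⟩
          · rw [hM2 i hij, hG2 i (by omega), hG2 (i + 1) (by omega)]
            obtain ⟨m1, m2, m3⟩ := hΛ' (2 * j + 1 - i) (by omega)
            rw [show 2 * j + 2 - i = 2 * j + 1 - i + 1 by omega,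
              show 2 * j + 2 - (i + 1) = 2 * j + 1 - i by omega]
            exact ⟨m2, m1, m3.symm⟩
      · intro i hi
        by_cases hij : i + 1 ≤ j
        · rw [hM1 i (by omega), hM1 (i + 1) hij]
          exact hnb i (by omega)
        · by_cases hij' : i = j
          · subst hij'
            rw [hM1 i le_rfl, hM2 (i + 1) (by omega), show 2 * i + 1 - (i + 1) = i by omega]
            exact hμ
          · rw [hM2 i (by omega), hM2 (i + 1) (by omega),
              show 2 * j + 1 - i = 2 * j + 1 - (i + 1) + 1 by omega]
            exact fun h => hnb' (2 * j + 1 - (i + 1)) (by omega) h.symm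

/-- **Girth counting lemma** (DETERMINISTIC-ALLX §4).  Let every participating gadget `a ∈ P` carry
`≥ 4` support letters `S a ⊆ Λ a`, each of which is also a support letter of another participating
gadget.  If the incidence structure `Λ` has no closed alternating walk of length `1 ≤ L ≤ 2j` that is
non-backtracking at interior points, then `3^j ≤ |P|` (for `P` nonempty). -/
theorem three_pow_le_card {Λ S : α → Finset β} {P : Finset α} (hP : P.Nonempty)
    (hS : ∀ a ∈ P, S a ⊆ Λ a) (h4 : ∀ a ∈ P, 4 ≤ (S a).card)
    (hcover : ∀ a ∈ P, ∀ μ ∈ S a, ∃ a' ∈ P, a' ≠ a ∧ μ ∈ S a') (j : ℕ)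
    (hgirth : ¬ HasShortClosedWalk Λ (2 * j)) : 3 ^ j ≤ P.card := by
  classical
  obtain ⟨a₀, ha₀⟩ := hP
  -- a default letter (any support letter of a₀)
  obtain ⟨μ₀, -⟩ : (S a₀).Nonempty := Finset.card_pos.mp (by have := h4 a₀ ha₀; omega)
  calc 3 ^ j ≤ (validWalks S P a₀ j).card := three_pow_le_card_validWalks ha₀ h4 hcover j
    _ ≤ P.card := by
        refine Finset.card_le_card_of_injOn (fun w => gadAt a₀ w j) (fun w hw => ?_) ?_
        · -- endpoints lie in P
          have hw' : w ∈ validWalks S P a₀ j := by simpa using hw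
          show gadAt a₀ w j ∈ (P : Set α)
          rw [Finset.mem_coe]
          rcases Nat.eq_zero_or_pos j with h0 | h0
          · subst h0; rw [gadAt_zero]; exact ha₀
          · have hv := mem_validWalks.mp hw'
            have := (hv.1 ⟨j - 1, by omega⟩).1
            have hg := gadAt_succ a₀ w (j - 1) (by omega)
            rw [show j - 1 + 1 = j by omega] at hg
            rw [hg]; exact this
        · intro w hw w' hw' h
          have h1 : w ∈ validWalks S P a₀ j := by simpa using hw
          have h2 : w' ∈ validWalks S P a₀ j := by simpa using hw'
          exact endGad_injOn μ₀ hS ha₀ j hgirth w h1 w' h2 h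

end Summit.ValiantsHypothesis.ValiantsHypothesis.Theorems.PeelingLemmaGirth
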